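import Literature.Barriers.CriticalPhenomena.LongRangeTrivialityOnZ3LocalityAudit
import HarnessLib

/-!
# Audit (D-0021, generation 7) of `LongRangeTrivialityOnZ3Proofs.lean`: PERTURBATIVE INSTABILITY —
# the nearest-neighbour model on `ℤ³` is a limit of Gaussian reflection-positive ferromagnets, so no
# monotone and no perturbation-stable argument reaches clause (iii); the Hamiltonian-level dividing
# quantity is the `3/2`-moment of the coupling

Barrier catalogue `Literature/Barriers/CriticalPhenomena/` (D-0021), sub-problem `Ising3DConformalLimit`.
Seventh audit record (refuter, barrier-audit mode, generation 7, 2026-08-15) for the sibling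
`LongRangeTrivialityOnZ3Proofs.lean` (discharge of `panis_variance_bound`) of the barrier
`LongRangeTrivialityOnZ3`, after generations 1–6 (`…ProofsAudit`: discharge CONFIRMED, technique class
extensional, lower half of the footnote literally false; `…BubbleAudit`: `BubbleTrivialityOnZ3` PROVED;
`…PointwiseAudit`; `…SusceptibilityAudit`: exact reach `χ_L(β_c) = o(L^{3/2})`; `…LocalityAudit`: the
locality route; generation 6: three negative checks). All six describe the contrary models of the barrier by
properties of their CRITICAL STATE (finite bubble, `χ_L = o(L^{3/2})`, anomalous decay) and the family by the
two points `{J_nn} ∪ {C₀|x-y|₁^{-3-α}}`, which are far apart as interactions. This audit attacks the barrier at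
the level of the HAMILTONIAN: which interactions near `J_nn` are contrary models? Answer (Panis's own general
theorem, read for the right interaction): ALL the heavy-tailed perturbations `J_nn + ε|x-y|₁^{-3-α}`, `ε > 0`,
`α < 3/2` — the nearest-neighbour coupling is a LIMIT POINT of the Gaussian domain. A separate leaf file is
used, as in generations 1–6, so that the modules importing `…Proofs` are not rebuilt.

## Verdict: NARROWED (the technique class, at the interaction level: "interaction-uniform over `Z3Model`"
## under-describes what is blocked — every MONOTONE-in-`J` and every `ℓ¹_s`-OPEN (`s < 3/2`) route is blocked
## too); the sharpened barrier `PerturbativeTrivialityOnZ3` is stated here and PROVED in the sibling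
## `LongRangeTrivialityOnZ3PerturbativeAuditProofs.lean` (`PerturbativeTrivialityOnZ3_holds`; second route in
## `LongRangeTrivialityOnZ3PerturbativeHolds.lean`); the audited discharge
## `panis_variance_bound_holds` CONFIRMED again (it is an input of `BubbleTrivialityOnZ3_holds`, through which
## everything below runs)

### A. What the sources print (page level, read for this audit)

* Panis, Theorem 5.5 (arXiv p. 21) is NOT restricted to the pure power law of Theorem 1.2: "Let `d ≥ 1`.
  Assume that `J` satisfies (A1)–(A5) and [(5.1): there exist `𝐂 > 0` and `η ∈ [0,2)` such that for all
  `x ≠ 0`, `⟨σ₀σ_x⟩_{β_c} ≤ 𝐂/|x|^{d-2+η}`, where `d + 2η > 4`]. There exist `C = C(𝐂,d), γ = γ(d) > 0` such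
  that for all `β ≤ β_c`, `L ≥ 1`, `f ∈ 𝒞₀(ℝ^d)` and `z ∈ ℝ`, `|⟨exp(zT_{f,L,β}(σ))⟩_β - exp(z²/2⟨T_{f,L,β}(σ)²⟩_β)|
  ≤ exp(z²/2⟨T_{|f|,L,β}(σ)²⟩_β) C(β⁻⁴∨β⁻²)‖f‖⁴_∞r_f^γz⁴/L^{d+2η-4}`"; "Remark 5.4. Note that the above
  assumption is automatically satisfied when the interaction `J` satisfies (A1)–(A5) and (assumption: decay
  algebraic on slices) with `d - 2(α∧2) > 0`." [cite: Panis2023Triviality, Theorem 5.5 and Remark 5.4, p. 21]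
* The slice assumption and the infrared bound it buys (p. 16): "there exist `c₀, C₀, α > 0` such that
  `c₀/k^{1+α} ≤ ∑_{|x|=k}J_{0,x} ≤ C₀/k^{1+α}`, `∀k ≥ 1`. Using Proposition 3.8 we get that reflection positive
  interactions satisfying the above assumption also satisfy: there exists `C = C(d) > 0` such that for all
  `β ≤ β_c(ρ)`, for all `x ∈ ℤ^d ∖ {0}`, `⟨τ₀τ_x⟩_{ρ,β} ≤ C/(β_c(ρ)) |x|^{-(d-α∧2)}(log|x|)^{δ_{α,2}}`."
  [cite: Panis2023Triviality, §3.6, the slice assumption and the display following it ("Using Proposition 3.8 we get …"), p. 16]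
* Reflection positivity of the perturbed couplings (p. 13): examples "(i) `J_{x,y} = 𝟙_{|x-y|₁=1}` … (iii)
  `J_{x,y} = C|x-y|₁^{-d-α}`", and "models of the GS class whose couplings are linear combinations with positive
  coefficients of the couplings mentioned above are also reflection-positive." [cite: Panis2023Triviality, §3.1, Definition 3.1 and examples (i)–(iv), p. 13];
  Aizenman–Fernández: "It should be noted here that the value of `J_x` for `x = 0` is not relevant …, and that
  reflection positivity is preserved under the addition of any nearest neighbor term — or in fact any other RP
  interaction", with the example "`J_x = 1/(‖x‖ + a²)^τ`, `‖x‖ = |x₁| + ⋯ + |x_d|`, for any `d ≥ 1` and `τ ≥ 0`"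
  and Proposition 3.1 (i) (`J_{‖x‖₁}` is RP in `ℤ^d` if `J` is RP in `ℤ`). [cite: AizenmanFernandez1988, §3, examples (1)–(3) and Proposition 3.1, p. 45]
* The framing by COMPONENTS of the interaction is Aizenman–Fernández's: "Long-range components of the
  interaction in statistical mechanical systems may affect the critical behavior, raising the system's
  'effective dimension'. … even in dimensions `d < 4` if a ferromagnetic Ising spin model has a
  reflection-positive pair interaction with a sufficiently slow decay, e.g. as `J_x = 1/|x|^{d+σ}` with
  `0 < σ ≤ d/2`, then the exponents `β̂, δ, γ` and `Δ₄` exist and take their mean-field values" (critical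
  EXPONENTS; Panis upgrades to the scaling limit). [cite: AizenmanFernandez1988, Abstract and eq. (1.3), pp. 39–40]
* The `d = 4` precedent for a Hamiltonian-level dividing quantity: "`𝔪₂(J) := ∑_x|x|²J_{0,x}`. When
  `𝔪₂(J) = ∞`, the decay of the interaction is slow enough to conclude using [the tree diagram bound].
  Theorem 1.3. Let `d = 4`. Assume that `J` satisfies (A1)–(A5), and that `𝔪₂(J) = ∞`. Then … every
  sub-sequential scaling limit of the model is Gaussian", versus (A6) / Theorem 1.5 (improved tree diagram
  bound) when `𝔪₂(J) < ∞`; and Proposition 3.23: under `𝔪₂(J) < ∞`, `⟨τ₀τ_x⟩ ≥ c/(β|x|^{d-1})` up to the sharp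
  length. [cite: Panis2023Triviality, Theorem 1.3, (A6), Theorem 1.5 and Remark 1.7 (p. 7); Proposition 3.23 (p. 16)]
* Relevance of the tail at the short-range fixed point (renormalisation group, not rigorous): "1. For
  `σ < d/2`, the critical point is a gaussian theory … 2. For `d/2 < σ < σ_*`, the critical point is a
  nontrivial, non-gaussian, theory … 3. for `σ > σ_*` … the LRI critical point is identical with the SRI
  critical point … `σ_* = d - 2Δ_φ^{SRI} ≡ 2 - η_{SRI}`" (Fisher–Ma–Nickel; Sak). [cite: PaulosEtAl2016, §1] [cite: Sak1973] [cite: FisherMaNickel1972]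

### B. What is proved here (all theorems; ONE definition of `Prop` type — the sharpened barrier
### `PerturbativeTrivialityOnZ3` — plus the coupling `perturbedNN` and the lattice injection `natTriple`; D-0026)

Namespace `LongRangeIsing`, `J^{(ε,α)} := perturbedNN ε α = 𝟙{|x-y|₁=1} + ε|x-y|₁^{-3-α}` on `ℤ³`:

* `perturbedNN_nonneg/_add/_eq_of_l1Norm_eq/_anti`, `nnCoupling_le_perturbedNN` (`J^{(ε,α)} ≥ J_nn`),
  `abs_perturbedNN_sub_nnCoupling_le` (`sup|J^{(ε,α)} - J_nn| ≤ |ε|`);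
* `perturbedNN_mms2` — MMS2 at every `β ≥ 0` (the tree's `ℓ¹`-radial Messager–Miracle-Solé machinery
  `state_pair_axisRefl_le`, `state_pair_diagRefl_le`, `walk_mms2`, unchanged);
* `not_hasNonGaussianSmearingZ3_perturbedNN_of_decay` — critical decay `‖x‖^{-θ}`, `θ > 3/2` ⟹ Gaussian
  critical smearings (`BubbleTrivialityOnZ3_holds`: the perturbed models are IN the bubble-blind class,
  `perturbedNN_mem_bubbleBlind`);
* TOPOLOGY: `summable_rpow_norm_mul_algebraicCoupling` (`∑_y‖y‖^s|y|₁^{-3-α} < ∞` iff-direction `s < α`),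
  `tsum_rpow_norm_mul_abs_perturbedNN_sub` (`‖J^{(ε,α)} - J_nn‖_{ℓ¹_s} = |ε|·const`),
  `tendsto_weightedDist_perturbedNN_nnCoupling` (`→ 0` as `ε → 0`, every `s < α`),
  `tendsto_perturbedNN_nnCoupling_uniform`;
* MOMENTS: `not_summable_rpow_norm_mul_algebraicCoupling` / `_perturbedNN` (`𝔪_s = ∞` for `s ≥ α`, by the
  `(k+1)²` points `(k,a,b)` and the harmonic series), `summable_rpow_norm_mul_nnCoupling` (`𝔪_s(J_nn) < ∞`).

Outside the namespace:

* `PerturbativeTrivialityOnZ3` (structured block below) — the catalogued statement (Panis Theorem 5.5 +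
  Remark 5.4 + §3.1): every `J^{(ε,α)}`, `ε > 0`, `0 < α < 3/2`, has Gaussian critical smearings; `.of_irb` —
  PROVED reduction to the single two-point input `HasCriticalDecay (perturbedNN ε α) (3 - α)` (the printed
  infrared bound of p. 16), DISCHARGED in the sibling `LongRangeTrivialityOnZ3PerturbativeAuditProofs.lean`
  (`PerturbativeTrivialityOnZ3_holds`; a second run of the route is `LongRangeTrivialityOnZ3PerturbativeHolds.lean`);
  `.pointwise_of_decay`;
* `.no_monotone_route` — no property `Φ` upward-closed in `J` and implying non-Gaussianity can hold at `J_nn`;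
* `.exists_gaussian_near_nn`, `.no_open_route` — `J_nn` is in the `ℓ¹_s`-closure (every `s < 3/2`; also
  uniformly, and from above) of the Gaussian domain; no `ℓ¹_s`-open condition at `J_nn` within reflection-positive
  ferromagnets implies non-Gaussianity;
* `moment_threeHalves_dichotomy` (unconditional) — `𝔪_{3/2}(J) = ∞` for every contrary model (perturbed or
  pure, `α < 3/2`), `𝔪_s(J_nn) < ∞` for all `s`: the light-tail input "`𝔪_{3/2}(J) < ∞`" is what separates the
  nearest-neighbour model from all of them.

### C. Consequences for the parent block (text; proposed separately as a docstring amendment)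

`LongRangeTrivialityOnZ3`, `technique_class`: append "AUDIT 2026-08-15, generation 7
(`LongRangeTrivialityOnZ3PerturbativeAudit.lean`): at the level of the INTERACTION the class is wider than
`InteractionUniformZ3` — the contrary models accumulate at `J_nn`: every `J_nn + ε|x-y|₁^{-3-α}` (`ε > 0`,
`α < 3/2`) is (A1)–(A5) with algebraic slices, hence Gaussian by Theorem 5.5/Remark 5.4 (`PerturbativeTrivialityOnZ3`,
PROVED: `PerturbativeTrivialityOnZ3_holds` in `…PerturbativeAuditProofs.lean`); consequently every argument with a step that is
upward-MONOTONE in `J` from `J_nn` (`no_monotone_route`) or `ℓ¹_s`-OPEN at `J_nn` for some `s < 3/2`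
(`no_open_route`) is blocked". `evasions_known`: append "the nearest-neighbour input must be DISCONTINUOUS at
`ε = 0` along `J_nn + ε|x-y|₁^{-3-α}`; the Hamiltonian-level separator is the light tail `𝔪_{3/2}(J) < ∞`
(`moment_threeHalves_dichotomy`; Panis's `d = 4` analysis is organised by `𝔪₂(J)` in the same way): finite range /
Markov property (generation 5), Proposition 3.23-type lower bounds under `𝔪₂ < ∞`, Duminil-Copin–Panis's
mirror-crossing bonds qualify; Griffiths-monotone comparisons `J ≥ J_nn`, expansions in the perturbation,
continuity of `β_c` or of local observables in `J` do not". `scope_caveats`: add "(j) the conjectural sharp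
threshold for perturbations of `J_nn` is `α = 3/2` (`𝔪_{3/2}`): for `3/2 < α < 2 - η_SR` a long-range
non-Gaussian fixed point, for `α > 2 - η_SR` the short-range class [PaulosEtAl2016 §1; Sak1973] — not rigorous".

### D. Literature (evasion search, generation 7)

Held and read at page level: Panis 2023 (pp. 5–7, 13–14, 16, 21), Aizenman–Fernández 1988 (pp. 39–40, 44–46).
`lit search --source arxiv` ≥ 2024 on "Panis Ising" (8: Liu–Panis–Slade torus plateau, van Engelenburg–Garban–
Panis one-arm exponents, Duminil-Copin–Panis 2025, Duminil-Copin–Markar–Panis–Slade 2026 "A random walk approach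
to high-dimensional critical phenomena" — all `d > d_c` or two-point level), "long-range Ising model two-point
function" (13: Affonso–Bissacot et al. 2025 cluster expansion; Liu 2025 EJP high-`d` long-range; Solfanelli–Defenu
2024 on the effective-dimension approach — none on `d = 3` non-triviality), "critical Ising model three dimensions
scaling limit" ≥ 2025 (2, irrelevant); `lit galaxy search --star pdf --mode bm25` on the stability question (15
physics hits, Defenu–Trombettoni–Ruffo long-range `O(N)`; nothing rigorous); `lit search --hybrid` unavailable /
uninformative during the session (recorded in NOTES). No published argument proves non-Gaussianity of any
ferromagnet on `ℤ³`; no published no-go phrased at the interaction level was found — the perturbative reading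
of Theorem 5.5 is this audit's.

## References

* R. Panis, arXiv:2309.05797 (2023) = Ann. Probab. 54 (2026): §1.2.1 (Theorem 1.2, p. 6; Theorem 1.3, (A6),
  Theorem 1.5, Remark 1.7, p. 7), §3.1 (Definition 3.1, examples, p. 13), Corollary 3.3 and Proposition 3.8
  (p. 14), §3.6 (the slice assumption, Proposition 3.23, p. 16), Definition 5.1, Remark 5.4, Theorem 5.5 (p. 21)
  [Panis2023Triviality] (held; read for this audit).
* M. Aizenman, R. Fernández, Lett. Math. Phys. 16 (1988) 39–49: Abstract, (1.3), §3 (examples, Proposition 3.1)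
  [AizenmanFernandez1988] (held; read pp. 39–40, 44–46).
* M. F. Paulos, S. Rychkov, B. C. van Rees, B. Zan, Nucl. Phys. B 902 (2016), §1 [PaulosEtAl2016];
  J. Sak, Phys. Rev. B 8 (1973) [Sak1973]; M. E. Fisher, S.-k. Ma, B. G. Nickel, PRL 29 (1972) [FisherMaNickel1972].
* H. Duminil-Copin, R. Panis, CMP 406 (2025), Theorems 1.2–1.3 [DuminilCopinPanis2025LowerBounds].

## Tree anchors

`BubbleTrivialityOnZ3_holds`, `Z3Model.coupling_nonneg/_add` (`…BubbleAudit`); `HasCriticalDecay`,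
`summable_sq_pairCorrelation_of_decay` (`…LocalityAudit`); `state_pair_axisRefl_le`, `state_pair_diagRefl_le`,
`pairCorrelation_zero_add_single_le`, `pairCorrelation_zero_add_single_sub_single_le`,
`pairCorrelation_zero_signedPerm`, `walk_mms2`, `algebraicCoupling_eq_of_l1Norm_eq`, `algebraicCoupling_anti`,
`l1Norm_eq_zero_iff` (`…MMSWalk`); `rowMajorant`, `summable_rowMajorant` (`…UrsellSum`); `algebraicCoupling_nonneg/_add`,
`criticalBeta_nonneg` (`…Proofs`); `Site.supNorm`, `Site.norm_eq_supNorm`, `Site.supNorm_le_iff`,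
`Site.natAbs_le_supNorm`, `Site.supNorm_eq_zero_iff`, `mem_box_iff_supNorm_le`, `zero_mem_box`; Mathlib:
`summable_prod_of_nonneg`, `Summable.comp_injective`, `Summable.sum_le_tsum`, `Real.not_summable_natCast_inv`,
`summable_mul_left_iff`, `summable_of_ne_finset_zero`, `Real.rpow_le_rpow_of_nonpos`,
`Real.rpow_le_rpow_of_exponent_le`, `tendsto_nhdsWithin_of_tendsto_nhds`.
-/

noncomputable section

namespace Literature.Barriers.CriticalPhenomena

open Literature.Probability.LatticeModels Literature.Probability.Percolation Filter Topology Finset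
open scoped symmDiff

namespace LongRangeIsing

/-! ### `ℓ¹` geometry -/

/-- `|0 - y|₁ = |y|₁`. [folklore] -/
theorem l1Norm_zero_sub {d : ℕ} (y : Site d) : l1Norm (0 - y) = l1Norm y := by
  simp [l1Norm, Int.natAbs_neg]

/-- `|y|_∞ ≤ |y|₁`. [folklore] -/
theorem supNorm_le_l1Norm {d : ℕ} (y : Site d) : Site.supNorm y ≤ l1Norm y := by
  rw [Site.supNorm_le_iff]
  intro i
  exact Finset.single_le_sum (f := fun j => (y j).natAbs) (fun j _ => Nat.zero_le _) (Finset.mem_univ i)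

/-- `|y|₁ ≤ d |y|_∞`. [folklore] -/
theorem l1Norm_le_mul_supNorm {d : ℕ} (y : Site d) : l1Norm y ≤ d * Site.supNorm y := by
  unfold l1Norm
  calc ∑ i, (y i).natAbs ≤ ∑ _i : Fin d, Site.supNorm y :=
        Finset.sum_le_sum fun i _ => Site.natAbs_le_supNorm y i
    _ = d * Site.supNorm y := by rw [Finset.sum_const, Finset.card_univ, Fintype.card_fin, smul_eq_mul]

/-- `y ≠ 0 → 1 ≤ |y|₁`. [folklore] -/
theorem one_le_l1Norm_of_ne_zero {d : ℕ} {y : Site d} (hy : y ≠ 0) : 1 ≤ l1Norm y :=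
  Nat.one_le_iff_ne_zero.2 fun h => hy (l1Norm_eq_zero_iff.1 h)

/-! ### The nearest-neighbour coupling as an `ℓ¹`-nonincreasing pair coupling -/

/-- `𝟙{|x-y|₁ = 1} ≤ 1`. [folklore] -/
theorem nnCoupling_le_one {d : ℕ} (x y : Site d) : nnCoupling d x y ≤ 1 := by
  unfold nnCoupling; split_ifs <;> norm_num

/-- The nearest-neighbour coupling depends on `x, y` only through `|x-y|₁`.
[cite: Panis2023Triviality, §1.2.1 (examples: nearest-neighbour interactions)] -/
theorem nnCoupling_eq_of_l1Norm_eq {d : ℕ} {x y x' y' : Site d} (h : l1Norm (x - y) = l1Norm (x' - y')) :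
    nnCoupling d x y = nnCoupling d x' y' := by
  unfold nnCoupling; rw [h]

/-- The nearest-neighbour coupling is nonincreasing in `|x-y|₁` off the diagonal. [folklore] -/
theorem nnCoupling_anti {d : ℕ} {x y y' : Site d} (hxy : x ≠ y) (h : l1Norm (x - y) ≤ l1Norm (x - y')) :
    nnCoupling d x y' ≤ nnCoupling d x y := by
  have h0 : 1 ≤ l1Norm (x - y) := one_le_l1Norm_of_ne_zero (sub_ne_zero.2 hxy)
  unfold nnCoupling
  split_ifs with h1 h2 h2
  · exact le_rfl
  · exfalso; omega
  · norm_num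
  · exact le_rfl

/-- `C₀|x-y|₁^{-d-α} = C₀ · (1·|x-y|₁^{-d-α})`. [folklore] -/
theorem algebraicCoupling_eq_mul_one {d : ℕ} (C₀ α : ℝ) (x y : Site d) :
    algebraicCoupling d C₀ α x y = C₀ * algebraicCoupling d 1 α x y := by
  unfold algebraicCoupling; split_ifs <;> ring

/-- `C₀|x-y|₁^{-d-α} ≤ C₀` for `C₀ ≥ 0`, `d + α ≥ 0` (`|x-y|₁ ≥ 1` off the diagonal). [folklore] -/
theorem algebraicCoupling_le {d : ℕ} {C₀ : ℝ} (hC₀ : 0 ≤ C₀) {α : ℝ} (hα : 0 ≤ (d : ℝ) + α) (x y : Site d) :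
    algebraicCoupling d C₀ α x y ≤ C₀ := by
  unfold algebraicCoupling
  split_ifs with hxy
  · exact hC₀
  · have h1 : (1 : ℝ) ≤ l1Norm (x - y) := by exact_mod_cast one_le_l1Norm_of_ne_zero (sub_ne_zero.2 hxy)
    have h2 : (l1Norm (x - y) : ℝ) ^ (-((d : ℝ) + α)) ≤ 1 :=
      Real.rpow_le_one_of_one_le_of_nonpos h1 (by linarith)
    nlinarith

/-! ### The heavy-tailed perturbations of the nearest-neighbour coupling -/

/-- **The perturbed nearest-neighbour couplings** `J^{(ε,α)}_{x,y} := 𝟙{|x-y|₁ = 1} + ε|x-y|₁^{-3-α}` on `ℤ³`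
(`x ≠ y`): a positive combination of Panis's examples (i) and (iii), hence satisfying (A1)–(A5)
("models … whose couplings are linear combinations with positive coefficients of the couplings mentioned
above are also reflection-positive"). [cite: Panis2023Triviality, §3.1 (examples (i), (iii) and the sentence on positive combinations), p. 13] -/
def perturbedNN (ε α : ℝ) (x y : Site 3) : ℝ := nnCoupling 3 x y + algebraicCoupling 3 ε α x y

variable {ε α : ℝ}

/-- The perturbed couplings are ferromagnetic for `ε ≥ 0`. [cite: Panis2023Triviality, §1.2.1 ((A1))] -/
theorem perturbedNN_nonneg (hε : 0 ≤ ε) (α : ℝ) (x y : Site 3) : 0 ≤ perturbedNN ε α x y :=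
  add_nonneg (Z3Model.coupling_nonneg .nearestNeighbour x y) (algebraicCoupling_nonneg hε α x y)

/-- The perturbed couplings are translation invariant. [cite: Panis2023Triviality, §1.2.1 ((A3))] -/
theorem perturbedNN_add (ε α : ℝ) (a x y : Site 3) : perturbedNN ε α (x + a) (y + a) = perturbedNN ε α x y := by
  have hnn : nnCoupling 3 (x + a) (y + a) = nnCoupling 3 x y := by
    unfold nnCoupling; rw [add_sub_add_right_eq_sub]
  unfold perturbedNN
  rw [hnn, algebraicCoupling_add]

/-- The perturbed couplings depend on `x, y` only through `|x-y|₁`. [folklore] -/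
theorem perturbedNN_eq_of_l1Norm_eq (ε α : ℝ) {x y x' y' : Site 3} (h : l1Norm (x - y) = l1Norm (x' - y')) :
    perturbedNN ε α x y = perturbedNN ε α x' y' := by
  unfold perturbedNN
  rw [nnCoupling_eq_of_l1Norm_eq h, algebraicCoupling_eq_of_l1Norm_eq ε α h]

/-- The perturbed couplings are nonincreasing in `|x-y|₁` off the diagonal (`ε ≥ 0`). [folklore] -/
theorem perturbedNN_anti (hε : 0 ≤ ε) (hα : 0 ≤ α) {x y y' : Site 3} (hxy : x ≠ y)
    (h : l1Norm (x - y) ≤ l1Norm (x - y')) : perturbedNN ε α x y' ≤ perturbedNN ε α x y :=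
  add_le_add (nnCoupling_anti hxy h) (algebraicCoupling_anti hε (by positivity) hxy h)

/-- The perturbed couplings dominate the nearest-neighbour one (`ε ≥ 0`). [folklore] -/
theorem nnCoupling_le_perturbedNN (hε : 0 ≤ ε) (α : ℝ) (x y : Site 3) : nnCoupling 3 x y ≤ perturbedNN ε α x y :=
  le_add_of_nonneg_right (algebraicCoupling_nonneg hε α x y)

/-- `J^{(ε,α)} - J_nn = ε|x-y|₁^{-3-α} = ε · J^{(1,α)}_alg`. [folklore] -/
theorem perturbedNN_sub_nnCoupling (ε α : ℝ) (x y : Site 3) :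
    perturbedNN ε α x y - nnCoupling 3 x y = ε * algebraicCoupling 3 1 α x y := by
  unfold perturbedNN
  rw [add_sub_cancel_left, algebraicCoupling_eq_mul_one]

/-- **Uniform smallness of the perturbation**: `|J^{(ε,α)}_{x,y} - J^{nn}_{x,y}| ≤ |ε|` (`α ≥ -3`). [folklore] -/
theorem abs_perturbedNN_sub_nnCoupling_le (hα : 0 ≤ 3 + α) (ε : ℝ) (x y : Site 3) :
    |perturbedNN ε α x y - nnCoupling 3 x y| ≤ |ε| := by
  rw [perturbedNN_sub_nnCoupling, abs_mul]
  have h0 : 0 ≤ algebraicCoupling 3 1 α x y := algebraicCoupling_nonneg zero_le_one α x y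
  have h1 : algebraicCoupling 3 1 α x y ≤ 1 := algebraicCoupling_le zero_le_one (by push_cast; linarith) x y
  rw [abs_of_nonneg h0]
  exact mul_le_of_le_one_right (abs_nonneg ε) h1

/-! ### Messager–Miracle-Solé monotonicity (MMS2) of the perturbed two-point functions -/

/-- **(MMS2) for the perturbed couplings**: for `ε, α, β ≥ 0` and `3‖x‖_∞ ≤ ‖y‖_∞`,
`⟨σ₀σ_y⟩_{J^{(ε,α)},β} ≤ ⟨σ₀σ_x⟩_{J^{(ε,α)},β}` — the Messager–Miracle-Solé inequality for `ℓ¹`-nonincreasing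
ferromagnetic pair couplings (`state_pair_axisRefl_le`, `state_pair_diagRefl_le`) and the walk `walk_mms2`,
exactly as for `C₀|x-y|₁^{-d-α}` (`panis_mms_two_point_monotone_holds`); Panis's Corollary 3.3 for this
(A1)–(A5) interaction. [cite: Panis2023Triviality, Corollary 3.3 (MMS2), p. 14] -/
theorem perturbedNN_mms2 (hε : 0 ≤ ε) (hα : 0 ≤ α) {β : ℝ} (hβ : 0 ≤ β) {x y : Site 3}
    (hxy : (3 : ℝ) * ‖x‖ ≤ ‖y‖) :
    pairCorrelation (perturbedNN ε α) β 0 y ≤ pairCorrelation (perturbedNN ε α) β 0 x := by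
  have hJ0 : ∀ a b : Site 3, 0 ≤ perturbedNN ε α a b := perturbedNN_nonneg hε α
  have hJl1 : ∀ a b a' b' : Site 3, l1Norm (a - b) = l1Norm (a' - b') →
      perturbedNN ε α a b = perturbedNN ε α a' b' := fun a b a' b' h => perturbedNN_eq_of_l1Norm_eq ε α h
  have hJanti : ∀ a b b' : Site 3, a ≠ b → l1Norm (a - b) ≤ l1Norm (a - b') →
      perturbedNN ε α a b' ≤ perturbedNN ε α a b := fun a b b' hab h => perturbedNN_anti hε hα hab h
  rw [Site.norm_eq_supNorm, Site.norm_eq_supNorm] at hxy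
  have h : 3 * Site.supNorm x ≤ Site.supNorm y := by exact_mod_cast hxy
  exact walk_mms2 (S := fun z => pairCorrelation (perturbedNN ε α) β 0 z)
    (fun z i hz => pairCorrelation_zero_add_single_le _ β hJ0 hJl1 hJanti hβ z i hz)
    (fun z i j hij hz => pairCorrelation_zero_add_single_sub_single_le _ β hJ0 hJl1 hJanti hβ z hij hz)
    (fun π e z => pairCorrelation_zero_signedPerm _ β hJl1 π e z) (by norm_num) h

/-! ### Critical decay forces Gaussianity of the perturbed models (the bubble-blind barrier applies) -/

/-- **A perturbed nearest-neighbour model with critical two-point decay `‖x‖^{-θ}`, `θ > 3/2`, has Gaussian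
critical smearings** (`ε, α ≥ 0`): its critical bubble is finite (`summable_sq_pairCorrelation_of_decay`) and
MMS2 holds (`perturbedNN_mms2`), so the PROVED barrier `BubbleTrivialityOnZ3_holds` applies — Panis's
Theorem 5.5 ("Assume that `J` satisfies (A1)–(A5) and [`⟨σ₀σ_x⟩_{β_c} ≤ 𝐂/|x|^{d-2+η}`, `d + 2η > 4`]") at
`β = β_c`, `d = 3`, where `d - 2 + η = θ > 3/2 ⟺ d + 2η > 4`.
[cite: Panis2023Triviality, Theorem 5.5 with assumption (5.1), p. 21] -/
theorem not_hasNonGaussianSmearingZ3_perturbedNN_of_decay (hε : 0 ≤ ε) (hα : 0 ≤ α) {θ : ℝ}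
    (hθ : 3 / 2 < θ) (h : HasCriticalDecay (perturbedNN ε α) θ) :
    ¬ HasNonGaussianSmearingZ3 (perturbedNN ε α) :=
  BubbleTrivialityOnZ3_holds _ (perturbedNN_nonneg hε α) (perturbedNN_add ε α)
    (fun _ _ _ hxy => perturbedNN_mms2 hε hα (criticalBeta_nonneg _) hxy)
    (summable_sq_pairCorrelation_of_decay _ (perturbedNN_nonneg hε α) hθ h)

/-! ### Topology: `J^{(ε,α)} → J_nn` as `ε → 0`, uniformly and in every weighted norm `ℓ¹_s`, `s < α` -/

/-- The weighted tails `‖y‖^s |y|₁^{-3-α}` are summable over `ℤ³` for `s < α` (comparison with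
`|y|_∞^{-(3+α-s)}`, `3 + α - s > 3`). [folklore] -/
theorem summable_rpow_norm_mul_algebraicCoupling {α s : ℝ} (hα : 0 < α) (hs : s < α) :
    Summable fun y : Site 3 => ‖y‖ ^ s * algebraicCoupling 3 1 α 0 y := by
  set q : ℝ := 3 + α - s with hq
  have hq3 : 3 < q := by rw [hq]; linarith
  have h0 : ∀ y : Site 3, 0 ≤ ‖y‖ ^ s * algebraicCoupling 3 1 α 0 y := fun y =>
    mul_nonneg (Real.rpow_nonneg (norm_nonneg _) _) (algebraicCoupling_nonneg zero_le_one α 0 y)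
  have hmaj : ∀ y : Site 3, ‖y‖ ^ s * algebraicCoupling 3 1 α 0 y ≤ rowMajorant 1 1 q 1 y := by
    intro y
    unfold rowMajorant
    split_ifs with hy
    · -- `|y|_∞ ≤ 1`: either `y = 0` (the term vanishes) or `‖y‖ = 1`
      by_cases hy0 : y = 0
      · subst hy0
        unfold algebraicCoupling
        simp
      · have h1 : Site.supNorm y = 1 := by
          have h2 : Site.supNorm y ≤ 1 := mem_box_iff_supNorm_le.1 hy
          have h3 : Site.supNorm y ≠ 0 := fun h => hy0 (Site.supNorm_eq_zero_iff.1 h)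
          omega
        rw [Site.norm_eq_supNorm, h1, Nat.cast_one, Real.one_rpow, one_mul]
        exact algebraicCoupling_le zero_le_one (by push_cast; linarith) 0 y
    · have hy0 : y ≠ 0 := fun h => hy (h ▸ zero_mem_box 3 1)
      have hn : ‖y‖ = (Site.supNorm y : ℝ) := Site.norm_eq_supNorm y
      have hpos : 0 < (Site.supNorm y : ℝ) := by
        have h' : Site.supNorm y ≠ 0 := fun h => hy0 (Site.supNorm_eq_zero_iff.1 h)
        positivity
      have hl1 : (Site.supNorm y : ℝ) ≤ (l1Norm (0 - y) : ℝ) := by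
        rw [l1Norm_zero_sub]; exact_mod_cast supNorm_le_l1Norm y
      have hJ : algebraicCoupling 3 1 α 0 y ≤ (Site.supNorm y : ℝ) ^ (-((3 : ℝ) + α)) := by
        unfold algebraicCoupling
        rw [if_neg (Ne.symm hy0), one_mul]
        push_cast
        exact Real.rpow_le_rpow_of_nonpos hpos hl1 (by linarith)
      calc ‖y‖ ^ s * algebraicCoupling 3 1 α 0 y
          ≤ (Site.supNorm y : ℝ) ^ s * (Site.supNorm y : ℝ) ^ (-((3 : ℝ) + α)) := by
            rw [hn]; exact mul_le_mul_of_nonneg_left hJ (Real.rpow_nonneg hpos.le _)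
        _ = 1 * (Site.supNorm y : ℝ) ^ (-q) := by
            rw [← Real.rpow_add hpos, one_mul, hq]; ring_nf
  exact (summable_rowMajorant zero_le_one zero_le_one hq3 le_rfl).1.of_nonneg_of_le h0 hmaj

/-- The weighted distance of `J^{(ε,α)}` to `J_nn` (at the base point, by translation invariance):
`∑_y ‖y‖^s |J^{(ε,α)}_{0,y} - J^{nn}_{0,y}| = |ε| ∑_y ‖y‖^s |y|₁^{-3-α}`. [folklore] -/
theorem tsum_rpow_norm_mul_abs_perturbedNN_sub (ε α s : ℝ) :
    ∑' y : Site 3, ‖y‖ ^ s * |perturbedNN ε α 0 y - nnCoupling 3 0 y| =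
      |ε| * ∑' y : Site 3, ‖y‖ ^ s * algebraicCoupling 3 1 α 0 y := by
  rw [← tsum_mul_left]
  refine tsum_congr fun y => ?_
  rw [perturbedNN_sub_nnCoupling, abs_mul, abs_of_nonneg (algebraicCoupling_nonneg zero_le_one α 0 y)]
  ring

/-- **`J^{(ε,α)} → J_nn` in the weighted norm `ℓ¹_s` for every `s < α`** (and the sum is finite):
the nearest-neighbour coupling is a limit point of the family `{J^{(ε,α)} : ε > 0}` in `ℓ¹_s(ℤ³)`,
`‖K‖_{ℓ¹_s} = ∑_y ‖y‖^s_∞ |K_{0,y}|`, for every `s < α`. [folklore] -/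
theorem tendsto_weightedDist_perturbedNN_nnCoupling {α s : ℝ} (hα : 0 < α) (hs : s < α) :
    (Summable fun y : Site 3 => ‖y‖ ^ s * algebraicCoupling 3 1 α 0 y) ∧
      Tendsto (fun ε : ℝ => ∑' y : Site 3, ‖y‖ ^ s * |perturbedNN ε α 0 y - nnCoupling 3 0 y|) (𝓝 0) (𝓝 0) := by
  refine ⟨summable_rpow_norm_mul_algebraicCoupling hα hs, ?_⟩
  set K : ℝ := ∑' y : Site 3, ‖y‖ ^ s * algebraicCoupling 3 1 α 0 y with hK
  simp_rw [tsum_rpow_norm_mul_abs_perturbedNN_sub]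
  have h : Tendsto (fun ε : ℝ => |ε| * K) (𝓝 0) (𝓝 (|0| * K)) := (continuous_abs.tendsto 0).mul_const K
  simpa using h

/-- **`J^{(ε,α)} → J_nn` uniformly**: `sup_{x,y} |J^{(ε,α)}_{x,y} - J^{nn}_{x,y}| ≤ |ε| → 0`. [folklore] -/
theorem tendsto_perturbedNN_nnCoupling_uniform {α : ℝ} (hα : 0 ≤ 3 + α) (x y : Site 3) :
    Tendsto (fun ε : ℝ => perturbedNN ε α x y) (𝓝 0) (𝓝 (nnCoupling 3 x y)) := by
  have h1 : Tendsto (fun ε : ℝ => ε * algebraicCoupling 3 1 α x y + nnCoupling 3 x y) (𝓝 0)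
      (𝓝 (0 * algebraicCoupling 3 1 α x y + nnCoupling 3 x y)) :=
    (tendsto_id.mul_const _).add_const _
  rw [zero_mul, zero_add] at h1
  refine h1.congr fun ε => ?_
  have h2 := perturbedNN_sub_nnCoupling ε α x y
  have _h3 := hα
  linarith

/-! ### The Hamiltonian-level quantity separating `J_nn` from every contrary model: moments of the coupling -/

/-- The lattice points `(k, a, b)`, `k, a, b ∈ ℕ`, of `ℤ³`. [folklore] -/
def natTriple (p : ℕ × ℕ × ℕ) : Site 3 := ![(p.1 : ℤ), (p.2.1 : ℤ), (p.2.2 : ℤ)]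

/-- First coordinate of `natTriple`. [folklore] -/
@[simp] theorem natTriple_zero (p : ℕ × ℕ × ℕ) : natTriple p 0 = p.1 := rfl

/-- Second coordinate of `natTriple`. [folklore] -/
@[simp] theorem natTriple_one (p : ℕ × ℕ × ℕ) : natTriple p 1 = p.2.1 := rfl

/-- Third coordinate of `natTriple`. [folklore] -/
@[simp] theorem natTriple_two (p : ℕ × ℕ × ℕ) : natTriple p 2 = p.2.2 := rfl

/-- `(k, a, b) ↦ (k, a, b)` is injective. [folklore] -/
theorem natTriple_injective : Function.Injective natTriple := by
  rintro ⟨k, a, b⟩ ⟨k', a', b'⟩ h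
  have h0 := congrFun h 0
  have h1 := congrFun h 1
  have h2 := congrFun h 2
  simp only [natTriple_zero, natTriple_one, natTriple_two, Nat.cast_inj] at h0 h1 h2
  simp [h0, h1, h2]

/-- `|(k,a,b)|_∞ = k` for `a, b ≤ k`. [folklore] -/
theorem supNorm_natTriple {k a b : ℕ} (ha : a ≤ k) (hb : b ≤ k) : Site.supNorm (natTriple (k, a, b)) = k := by
  refine le_antisymm (Site.supNorm_le_iff.2 fun i => ?_) ?_
  · fin_cases i <;> simp [ha, hb]
  · have h := Site.natAbs_le_supNorm (natTriple (k, a, b)) 0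
    simpa using h

/-- `|(k,a,b)|₁ = k + a + b`. [folklore] -/
theorem l1Norm_natTriple (k a b : ℕ) : l1Norm (natTriple (k, a, b)) = k + a + b := by
  unfold l1Norm
  rw [Fin.sum_univ_three]
  simp

/-- **Infinite moments of the power-law couplings**: `∑_y ‖y‖^s_∞ · C₀|y|₁^{-3-α} = ∞` for `s ≥ α`
(`C₀ > 0`, `α ≥ 0`): on the `(k+1)²` points `(k,a,b)`, `0 ≤ a, b ≤ k`, the term is at least
`C₀3^{-3-α}k^{-3}`, and `∑_k (k+1)²k^{-3} = ∞`. [folklore] -/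
theorem not_summable_rpow_norm_mul_algebraicCoupling {C₀ α s : ℝ} (hC₀ : 0 < C₀) (hα : 0 ≤ α) (hs : α ≤ s) :
    ¬ Summable fun y : Site 3 => ‖y‖ ^ s * algebraicCoupling 3 C₀ α 0 y := by
  intro hsum
  set f : Site 3 → ℝ := fun y => ‖y‖ ^ s * algebraicCoupling 3 C₀ α 0 y with hf
  have hf0 : ∀ y, 0 ≤ f y := fun y =>
    mul_nonneg (Real.rpow_nonneg (norm_nonneg _) _) (algebraicCoupling_nonneg hC₀.le α 0 y)
  -- pull back along the injection `(k,a,b) ↦ (k,a,b)`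
  have hg : Summable (f ∘ natTriple) := hsum.comp_injective natTriple_injective
  have hg0 : 0 ≤ f ∘ natTriple := fun p => hf0 _
  obtain ⟨-, hrow⟩ := (summable_prod_of_nonneg hg0).1 hg
  -- the constant `c = C₀ 3^{-(3+α)}`
  set c : ℝ := C₀ * (3 : ℝ) ^ (-((3 : ℝ) + α)) with hc
  have hcpos : 0 < c := mul_pos hC₀ (Real.rpow_pos_of_pos (by norm_num) _)
  -- pointwise lower bound on the `(k+1)²` good points of the `k`-th slice
  have hpt : ∀ k : ℕ, 1 ≤ k → ∀ p ∈ Finset.range (k + 1) ×ˢ Finset.range (k + 1),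
      c * ((k : ℝ) ^ 3)⁻¹ ≤ (f ∘ natTriple) (k, p) := by
    intro k hk p hp
    obtain ⟨a, b⟩ := p
    rw [Finset.mem_product, Finset.mem_range, Finset.mem_range] at hp
    obtain ⟨ha, hb⟩ := hp
    have ha' : a ≤ k := by omega
    have hb' : b ≤ k := by omega
    have hkpos : (0 : ℝ) < k := by exact_mod_cast hk
    have hk1 : (1 : ℝ) ≤ k := by exact_mod_cast hk
    have hy0 : natTriple (k, a, b) ≠ 0 := by
      intro h
      have := congrFun h 0
      simp at this
      omega
    have hnorm : ‖natTriple (k, a, b)‖ = (k : ℝ) := by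
      rw [Site.norm_eq_supNorm, supNorm_natTriple ha' hb']
    have hl1 : (l1Norm (0 - natTriple (k, a, b)) : ℝ) = (k : ℝ) + a + b := by
      rw [l1Norm_zero_sub, l1Norm_natTriple]; push_cast; ring
    have hl1pos : (0 : ℝ) < (k : ℝ) + a + b := by positivity
    have hl1le : (k : ℝ) + a + b ≤ 3 * k := by
      have : (a : ℝ) ≤ k := by exact_mod_cast ha'
      have : (b : ℝ) ≤ k := by exact_mod_cast hb'
      linarith
    -- the coupling at `(k,a,b)`
    have hJ : c * (k : ℝ) ^ (-((3 : ℝ) + α)) ≤ algebraicCoupling 3 C₀ α 0 (natTriple (k, a, b)) := by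
      unfold algebraicCoupling
      rw [if_neg (Ne.symm hy0), hl1, hc, mul_assoc, ← Real.mul_rpow (by norm_num) hkpos.le]
      push_cast
      refine mul_le_mul_of_nonneg_left ?_ hC₀.le
      exact Real.rpow_le_rpow_of_nonpos hl1pos hl1le (by linarith)
    -- the weight at `(k,a,b)`
    have hW : (k : ℝ) ^ α ≤ ‖natTriple (k, a, b)‖ ^ s := by
      rw [hnorm]; exact Real.rpow_le_rpow_of_exponent_le hk1 hs
    have hprod : (k : ℝ) ^ α * (c * (k : ℝ) ^ (-((3 : ℝ) + α))) = c * ((k : ℝ) ^ 3)⁻¹ := by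
      have h1 : (k : ℝ) ^ α * (k : ℝ) ^ (-((3 : ℝ) + α)) = (k : ℝ) ^ (-(3 : ℝ)) := by
        rw [← Real.rpow_add hkpos]; ring_nf
      have h2 : (k : ℝ) ^ (-(3 : ℝ)) = ((k : ℝ) ^ 3)⁻¹ := by
        rw [Real.rpow_neg hkpos.le]
        norm_num
      calc (k : ℝ) ^ α * (c * (k : ℝ) ^ (-((3 : ℝ) + α)))
          = c * ((k : ℝ) ^ α * (k : ℝ) ^ (-((3 : ℝ) + α))) := by ring
        _ = c * ((k : ℝ) ^ 3)⁻¹ := by rw [h1, h2]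
    calc c * ((k : ℝ) ^ 3)⁻¹ = (k : ℝ) ^ α * (c * (k : ℝ) ^ (-((3 : ℝ) + α))) := hprod.symm
      _ ≤ ‖natTriple (k, a, b)‖ ^ s * algebraicCoupling 3 C₀ α 0 (natTriple (k, a, b)) :=
          mul_le_mul hW hJ (by positivity) (Real.rpow_nonneg (norm_nonneg _) _)
  -- slice sums: `∑'_{(a,b)} f(k,a,b) ≥ (k+1)² c k^{-3} ≥ c/k`
  have hslice : ∀ k : ℕ, c * (k : ℝ)⁻¹ ≤ ∑' p : ℕ × ℕ, (f ∘ natTriple) (k, p) := by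
    intro k
    rcases Nat.eq_zero_or_pos k with rfl | hk
    · simp only [Nat.cast_zero, inv_zero, mul_zero]
      exact tsum_nonneg fun p => hg0 _
    have hk' : 1 ≤ k := hk
    have hkpos : (0 : ℝ) < k := by exact_mod_cast hk
    have hrowk : Summable fun p : ℕ × ℕ => (f ∘ natTriple) (k, p) :=
      ((summable_prod_of_nonneg hg0).1 hg).1 k
    calc c * (k : ℝ)⁻¹ ≤ ((k : ℝ) + 1) ^ 2 * (c * ((k : ℝ) ^ 3)⁻¹) := by
          have h1 : (k : ℝ)⁻¹ = (k : ℝ) ^ 2 * ((k : ℝ) ^ 3)⁻¹ := by field_simp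
          rw [h1]
          have h2 : 0 ≤ c * ((k : ℝ) ^ 3)⁻¹ := by positivity
          nlinarith
      _ = ∑ _p ∈ Finset.range (k + 1) ×ˢ Finset.range (k + 1), c * ((k : ℝ) ^ 3)⁻¹ := by
          rw [Finset.sum_const, Finset.card_product, Finset.card_range, nsmul_eq_mul]
          push_cast; ring
      _ ≤ ∑ p ∈ Finset.range (k + 1) ×ˢ Finset.range (k + 1), (f ∘ natTriple) (k, p) :=
          Finset.sum_le_sum fun p hp => hpt k hk' p hp
      _ ≤ ∑' p : ℕ × ℕ, (f ∘ natTriple) (k, p) :=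
          hrowk.sum_le_tsum _ fun p _ => hg0 _
  -- hence `∑_k c/k < ∞`, absurd
  have hharm : Summable fun k : ℕ => c * (k : ℝ)⁻¹ :=
    hrow.of_nonneg_of_le (fun k => by positivity) hslice
  exact Real.not_summable_natCast_inv ((summable_mul_left_iff hcpos.ne').1 hharm)

/-- The same for the perturbed couplings (`ε > 0`): `𝔪_s(J^{(ε,α)}) := ∑_y ‖y‖^s J^{(ε,α)}_{0,y} = ∞` for
every `s ≥ α`. [folklore] -/
theorem not_summable_rpow_norm_mul_perturbedNN (hε : 0 < ε) (hα : 0 ≤ α) {s : ℝ} (hs : α ≤ s) :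
    ¬ Summable fun y : Site 3 => ‖y‖ ^ s * perturbedNN ε α 0 y := fun h =>
  not_summable_rpow_norm_mul_algebraicCoupling hε hα hs
    (h.of_nonneg_of_le (fun y => mul_nonneg (Real.rpow_nonneg (norm_nonneg _) _) (algebraicCoupling_nonneg hε.le α 0 y))
      fun y => mul_le_mul_of_nonneg_left
        (le_add_of_nonneg_left (Z3Model.coupling_nonneg .nearestNeighbour 0 y)) (Real.rpow_nonneg (norm_nonneg _) _))

/-- **All moments of the nearest-neighbour coupling are finite**: `𝔪_s(J_nn) = ∑_y ‖y‖^s 𝟙{|y|₁=1} < ∞`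
for every `s` (a finite sum over `Λ₁`). [folklore] -/
theorem summable_rpow_norm_mul_nnCoupling (s : ℝ) : Summable fun y : Site 3 => ‖y‖ ^ s * nnCoupling 3 0 y := by
  refine summable_of_ne_finset_zero (s := box 3 1) fun y hy => ?_
  have h1 : 1 < Site.supNorm y := not_le.1 fun h => hy (mem_box_iff_supNorm_le.2 h)
  have h2 : l1Norm (0 - y) ≠ 1 := by
    rw [l1Norm_zero_sub]
    have := supNorm_le_l1Norm y
    omega
  unfold nnCoupling
  rw [if_neg h2, mul_zero]

end LongRangeIsing

open LongRangeIsing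

/-- **Barrier `PerturbativeTrivialityOnZ3` (sharpened, interaction-level form of `LongRangeTrivialityOnZ3`; audit
2026-08-15, generation 7).** On `ℤ³`, EVERY heavy-tailed perturbation of the nearest-neighbour ferromagnet,
`J^{(ε,α)}_{x,y} = 𝟙{|x-y|₁=1} + ε|x-y|₁^{-3-α}` with `ε > 0` and `0 < α < 3/2`, has Gaussian critical smeared
scaling limits: `¬ HasNonGaussianSmearingZ3 (perturbedNN ε α)`. NAMED FACT — Panis's Theorem 5.5 ("Assume that
`J` satisfies (A1)–(A5) and [`⟨σ₀σ_x⟩_{β_c} ≤ 𝐂/|x|^{d-2+η}`, `d + 2η > 4`] … As a consequence … Gaussian") with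
Remark 5.4 (automatic under (A1)–(A5) and algebraic decay on slices with `d - 2(α∧2) > 0`) applied to
`J^{(ε,α)}`, which is reflection positive as a positive combination of examples (i) and (iii) of §3.1 and has
slices `∑_{|x|=k}J^{(ε,α)}_{0,x} ≍_ε k^{-1-α}` (`k ≥ 2`). Users take `(h : PerturbativeTrivialityOnZ3)`; it is
REDUCED in the tree to its one two-point input, the `x`-space infrared bound at `β_c` with exponent `3 - α`
(`PerturbativeTrivialityOnZ3.of_irb`, PROVED, through `BubbleTrivialityOnZ3_holds` and `perturbedNN_mms2`), and
DISCHARGED: `PerturbativeTrivialityOnZ3_holds` (`LongRangeTrivialityOnZ3PerturbativeAuditProofs.lean`; second route in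
`LongRangeTrivialityOnZ3PerturbativeHolds.lean`) proves that input by the torus route run for the SUM coupling.

BARRIER (structured block, D-0021):
- technique_class: perturbation-stable and monotone arguments on `ℤ³` — arguments for non-triviality of the critical nearest-neighbour model (clause (iii), smeared form `HasNonGaussianSmearingZ3`) at least one step of which either (a) survives the perturbations `J_nn ↦ J_nn + ε|x-y|₁^{-3-α}` for all small `ε > 0` and some `α < 3/2` — in particular every step that is an `ℓ¹_s`-OPEN condition at `J_nn` within reflection-positive ferromagnetic pair interactions for some `s < α` (formally the hypothesis `hopen` of `no_open_route`), or (b) is upward-MONOTONE in the coupling from `J_nn` within ferromagnetic translation-invariant couplings (the hypothesis `hmono` of `no_monotone_route`: Griffiths-type comparisons "`J ≥ J_nn` ⟹ …"); it complements the extensional class `InteractionUniformZ3` of the parent (whose contrary models `C₀|x-y|₁^{-3-α}` are far from `J_nn`) by contrary models ACCUMULATING AT `J_nn` — "Long-range components of the interaction … may affect the critical behavior, raising the system's 'effective dimension'" [cite: AizenmanFernandez1988, Abstract, p. 39] [cite: Panis2023Triviality, Theorem 5.5 and Remark 5.4, p. 21]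
- blocks: `HasNonGaussianSmearingZ3 (perturbedNN ε α)` for all `ε > 0`, `0 < α < 3/2`; hence (`no_monotone_route`) no property upward-closed in `J` and implying non-Gaussianity holds at `J_nn`, and (`exists_gaussian_near_nn`, `no_open_route`) `J_nn` lies in the closure of the Gaussian domain in every `ℓ¹_s(ℤ³)`, `s < 3/2` (weights `‖y‖^s_∞`), uniformly, and from above (`J ≥ J_nn`) — a proof of clause (iii) for the nearest-neighbour model must use an input destroyed by arbitrarily small heavy-tailed reflection-positive perturbations [cite: Panis2023Triviality, Theorem 5.5 and Remark 5.4, p. 21]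
- because: reflection positivity is preserved under positive combinations — "reflection positivity is preserved under the addition of any nearest neighbor term — or in fact any other RP interaction" [cite: AizenmanFernandez1988, §3, p. 45] [cite: Panis2023Triviality, §3.1, p. 13]; the infrared bound sees only `Ĵ(0) - Ĵ(p) = 2∑_x sin²(p·x/2)J_{0,x} ≥ ε(Ĵ_α(0) - Ĵ_α(p))`, so the slice condition and Proposition 3.8 give `⟨σ₀σ_x⟩_{β_c} ≤ C_ε/|x|^{3-α}` however small `ε` is [cite: Panis2023Triviality, Proposition 3.4, Remark 3.5, Proposition 3.8 (p. 14) and §3.6 (p. 16)]; then the critical bubble is finite (`3 - α > 3/2`), MMS2 holds for every `ℓ¹`-radially nonincreasing ferromagnetic coupling (`perturbedNN_mms2`) [cite: Panis2023Triviality, Corollary 3.3, p. 14], and the tree-diagram mechanism forces Gaussianity (`BubbleTrivialityOnZ3_holds`) [cite: Panis2023Triviality, Theorem 5.5 (p. 21) and Theorem 12.2 (p. 51)]; in renormalisation-group language the perturbation is RELEVANT at the short-range fixed point for `α < 2 - η_SR`, so no `ε > 0` is small — indeed `‖J^{(ε,α)} - J_nn‖_{ℓ¹_s} = ε∑_y‖y‖^s|y|₁^{-3-α}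 = ∞` for `s ≥ α` (`not_summable_rpow_norm_mul_algebraicCoupling`) [cite: PaulosEtAl2016, §1] [cite: Sak1973]
- evasions_known: inputs DISCONTINUOUS at `ε = 0` along the family evade it; the Hamiltonian-level separator is the light tail — `𝔪_{3/2}(J) = ∑_y‖y‖^{3/2}J_{0,y} = ∞` for every contrary model (perturbed or pure, `α < 3/2`) while `𝔪_s(J_nn) < ∞` for all `s` (`moment_threeHalves_dichotomy`); Panis's own `d = 4` analysis is organised by exactly such a quantity, `𝔪₂(J)` ("When `𝔪₂(J) = ∞`, the decay of the interaction is slow enough to conclude using [the tree diagram bound]"; (A6) and the improved tree diagram bound otherwise; Proposition 3.23: `⟨τ₀τ_x⟩ ≥ c/(β|x|^{d-1})` below the sharp length under `𝔪₂(J) < ∞`) [cite: Panis2023Triviality, Theorem 1.3, (A6), Theorem 1.5 (p. 7) and Proposition 3.23 (p. 16)]; qualifying nearest-neighbour-specific inputs in print: finite range / the Markov property behind reflected currents ("an appropriate application of the switching principle to a reflected current", bonds crossing the mirror) giving `B(β_c) = ∞` and the lower bound of Theorem 1.3 on `ℤ³` [cite: DuminilCopinPanis2025LowerBounds, Theorems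 1.2, 1.3 and 1.8], and the locality route of generation 5 (`LongRangeTrivialityOnZ3LocalityAudit.lean`); NOT evasions: Griffiths-monotone comparisons with `J_nn` (`no_monotone_route`), convergent expansions in the perturbation, and any input continuous along the family at `ε = 0` — e.g. the value of `β_c` (upper semicontinuous by Griffiths' inequality since `J^{(ε,α)} ≥ J_nn`, lower semicontinuous by the finite-volume criterion "`φ_β(S) < 1` for a finite `S ∋ 0` ⟹ `χ(β) ≤ |S|⟨τ₀²⟩/(1 - φ_β(S)) < ∞`" applied to a set `S` that works for `J_nn` at `β < β_c(J_nn)`, the tail `ε∑_{y∉S}|x-y|₁^{-3-α}` being small [cite: Panis2023Triviality, Remark 3.22, p. 16]) or finitely many finite-volume Gibbs expectations (continuous in the couplings); the expected (non-rigorous) picture beyond the barrier: for `3/2 < α < 2 - η_SR` the perturbed models flow to a long-range NON-Gaussian fixed point (constructed for the weakly coupled `|φ|⁴` model with `α = (3+ε)/2` [cite: Slade2017, Theorem 1.4.1], critical two-point decay `|x|^{-(d-α)}` [cite: LohmannSladeWallace2017]), for `α > 2 - η_SR` to the short-range one [cite: PaulosEtAl2016, §1] [cite: BrezinParisiRiccitersenghi2014]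 — so the conjectural sharp threshold for perturbations of `J_nn` is `α = 3/2`, i.e. `𝔪_{3/2}`
- scope_caveats: (a) the Gaussianity of `J^{(ε,α)}` is printed (Theorem 5.5 via Remark 5.4 and §3.1) and, in the tree, a THEOREM: the `def` below is kept as the catalogued statement, `of_irb` reduces it to the ONE input `HasCriticalDecay (perturbedNN ε α) (3 - α)` — the display of p. 16 for reflection-positive interactions with algebraic slices — and `PerturbativeTrivialityOnZ3_holds` (`LongRangeTrivialityOnZ3PerturbativeAuditProofs.lean`; a second run with different constants in `LongRangeTrivialityOnZ3PerturbativeHolds.lean`) proves that input by the torus route of `panis_infraredBound_algebraic_holds` (`LongRangeTrivialityOnZ3InfraredBoundHolds.lean`) run for the periodised SUM: reflection positivity of the periodised nearest-neighbour coupling (its crossing kernel on the positive half of a bond mirror is diagonal, `LongRangeIsing.torusCoupling_nn_reflectionPositive`, `LongRangeIsing.torusCoupling_nn_crossing_eq_zero`) plus that of the power law, Gaussian domination `wInfraredBound` with the Fourier gap of the sum bounded below by that of the power-law part, and the coupling-generic zero-mode, Riemann-sum, MMS and left-continuity steps; (b) the printed proof of Theorem 5.5 passes through Theorem 3.18, whose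 Appendix route uses diagonal reflection positivity, unavailable for `ℓ¹` power laws (`LongRangeIsing.algebraicCoupling_diag_not_posSemidef`, `LongRangeTrivialityOnZ3NoSlidingScale.lean`); `of_irb` uses the tree's Theorem-3.18-free mechanism (`BubbleTrivialityOnZ3_holds`), so only Proposition 3.8 (coordinate mirrors) is relied upon in print; (c) smeared averages, the free-boundary box-limit state and the tree's `β_c = sInf{β > 0 | m*(β) > 0}` exactly as in the parent's caveat (a) (`β_c = 0` handled by independence inside `BubbleTrivialityOnZ3_holds`); (d) only the one-parameter family `J_nn + ε|x-y|₁^{-3-α}` is formalised; the printed scope is every (A1)–(A5) interaction with algebraic slices and `α < 3/2`, e.g. `J + ε|x-y|₁^{-3-α}` for any reflection-positive `ℓ¹`-radial ferromagnet `J` of faster decay; (e) the topology is `ℓ¹_s` with sup-norm weights at the base point (translation invariance); the perturbations are NOT small in `ℓ¹_s` for `s ≥ α`, which is the renormalisation-group relevance, and nothing is claimed for `s ≥ 3/2`; (f) nothing here bears on perturbations with `α ≥ 3/2`, nor on the marginal `α = 3/2`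
- status: established (in print [cite: Panis2023Triviality, Theorem 5.5 and Remark 5.4, p. 21]; mean-field EXPONENTS for such interactions [cite: AizenmanFernandez1988, Abstract and Proposition 2.2]) and PROVED in the tree: `PerturbativeTrivialityOnZ3_holds` (`LongRangeTrivialityOnZ3PerturbativeAuditProofs.lean`; through `PerturbativeTrivialityOnZ3.of_irb` and `LongRangeIsing.hasCriticalDecay_perturbedNN`; second route `LongRangeTrivialityOnZ3PerturbativeHolds.lean`), all consequences unconditional (axioms `propext`, `Classical.choice`, `Quot.sound`)

[cite: Panis2023Triviality, Theorem 5.5 and Remark 5.4, p. 21] -/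
def PerturbativeTrivialityOnZ3 : Prop :=
  ∀ (ε α : ℝ), 0 < ε → 0 < α → α < 3 / 2 → ¬ HasNonGaussianSmearingZ3 (perturbedNN ε α)

/-- **The sharpened barrier, granted the infrared bound for the perturbed couplings** (Panis 2023, display
following Proposition 3.23, p. 16: any reflection-positive interaction with
`c₀k^{-1-α} ≤ ∑_{|x|=k}J_{0,x} ≤ C₀k^{-1-α}` has `⟨σ₀σ_x⟩_β ≤ C/(β_c|x|^{d-α∧2})` for `β ≤ β_c`, `x ≠ 0`;
the couplings `J^{(ε,α)}` satisfy both (A1)–(A5) and this slice condition): the `x`-space infrared bound at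
`β_c` with exponent `3 - α > 3/2` is the ONLY input not formalised (the tree's torus route
`panis_infraredBound_algebraic_holds` is written for the pure power law).
[cite: Panis2023Triviality, §3.6, display following Proposition 3.23 (p. 16), with Proposition 3.8 and Remark 5.4] -/
theorem PerturbativeTrivialityOnZ3.of_irb
    (hirb : ∀ ε α : ℝ, 0 < ε → 0 < α → α < 3 / 2 → HasCriticalDecay (perturbedNN ε α) (3 - α)) :
    PerturbativeTrivialityOnZ3 := fun ε α hε hα hα' =>
  not_hasNonGaussianSmearingZ3_perturbedNN_of_decay hε.le hα.le (by linarith) (hirb ε α hε hα hα')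

/-- Pointwise form: one perturbed model, granted its own infrared bound (any exponent `θ > 3/2`).
[cite: Panis2023Triviality, Theorem 5.5, p. 21] -/
theorem PerturbativeTrivialityOnZ3.pointwise_of_decay {ε α θ : ℝ} (hε : 0 ≤ ε) (hα : 0 ≤ α) (hθ : 3 / 2 < θ)
    (h : HasCriticalDecay (perturbedNN ε α) θ) : ¬ HasNonGaussianSmearingZ3 (perturbedNN ε α) :=
  not_hasNonGaussianSmearingZ3_perturbedNN_of_decay hε hα hθ h

/-! ### What the sharpened barrier blocks: monotone routes and open (perturbation-stable) routes -/

/-- **No monotone route.** Granted the barrier, no property `Φ` of couplings that is upward-closed under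
`J ≤ J'` (within ferromagnetic translation-invariant couplings) and implies a non-Gaussian critical smearing
can hold for the nearest-neighbour model: `Φ(J_nn)` would propagate to `Φ(J_nn + ε|x-y|₁^{-4})`, which is
Gaussian. In particular "`J ≥ J_nn`, (A1)–(A5) ⟹ non-Gaussian" is false, and Griffiths-type comparison
arguments starting from the nearest-neighbour model cannot reach clause (iii). [cite: Panis2023Triviality, Theorem 5.5 and Remark 5.4, p. 21] -/
theorem PerturbativeTrivialityOnZ3.no_monotone_route (h : PerturbativeTrivialityOnZ3)
    (Φ : (Site 3 → Site 3 → ℝ) → Prop)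
    (hmono : ∀ J J' : Site 3 → Site 3 → ℝ, (∀ x y, J x y ≤ J' x y) → (∀ x y, 0 ≤ J' x y) →
      (∀ a x y, J' (x + a) (y + a) = J' x y) → Φ J → Φ J')
    (hΦ : ∀ J, Φ J → HasNonGaussianSmearingZ3 J) : ¬ Φ (nnCoupling 3) := fun hnn =>
  h 1 1 one_pos one_pos (by norm_num)
    (hΦ _ (hmono _ _ (nnCoupling_le_perturbedNN zero_le_one 1) (perturbedNN_nonneg zero_le_one 1)
      (perturbedNN_add 1 1) hnn))

/-- **The nearest-neighbour coupling is a limit of (granted the barrier) Gaussian members, in every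
`ℓ¹_s`, `s < 3/2`, and uniformly — by members dominating it and having an infinite `3/2`-moment.** For
`s < 3/2` and `δ > 0` there is `J = J^{(ε,α)}` (`s ∨ 1 < α < 3/2`, `ε` small) with `J ≥ J_nn`,
`sup|J - J_nn| < δ`, `∑_y‖y‖^s|J_{0,y} - J^{nn}_{0,y}| < δ` (a convergent sum), `𝔪_{3/2}(J) = ∞`, and
`¬ HasNonGaussianSmearingZ3 J`.
[cite: Panis2023Triviality, Theorem 5.5 and Remark 5.4, p. 21] -/
theorem PerturbativeTrivialityOnZ3.exists_gaussian_near_nn (h : PerturbativeTrivialityOnZ3) {s : ℝ}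
    (hs : s < 3 / 2) {δ : ℝ} (hδ : 0 < δ) :
    ∃ J : Site 3 → Site 3 → ℝ,
      (∀ x y, nnCoupling 3 x y ≤ J x y) ∧ (∀ x y, |J x y - nnCoupling 3 x y| < δ) ∧
      (Summable fun y : Site 3 => ‖y‖ ^ s * |J 0 y - nnCoupling 3 0 y|) ∧
      (∑' y : Site 3, ‖y‖ ^ s * |J 0 y - nnCoupling 3 0 y|) < δ ∧
      (¬ Summable fun y : Site 3 => ‖y‖ ^ ((3 : ℝ) / 2) * J 0 y) ∧
      ¬ HasNonGaussianSmearingZ3 J := by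
  set α : ℝ := (max s 1 + 3 / 2) / 2 with hα
  have hmax : max s 1 < 3 / 2 := max_lt hs (by norm_num)
  have hα1 : max s 1 < α := by rw [hα]; linarith
  have hα2 : α < 3 / 2 := by rw [hα]; linarith
  have hαs : s < α := lt_of_le_of_lt (le_max_left _ _) hα1
  have hα0 : 0 < α := lt_of_le_of_lt (by positivity) hα1
  set K : ℝ := ∑' y : Site 3, ‖y‖ ^ s * algebraicCoupling 3 1 α 0 y with hK
  have hK0 : 0 ≤ K := tsum_nonneg fun y =>
    mul_nonneg (Real.rpow_nonneg (norm_nonneg _) _) (algebraicCoupling_nonneg zero_le_one α 0 y)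
  set ε : ℝ := δ / (2 * (K + 1)) with hε
  have hε0 : 0 < ε := by positivity
  have hεδ : ε < δ := by
    rw [hε, div_lt_iff₀ (by positivity)]
    nlinarith
  have hεK : ε * K < δ := by
    rw [hε, div_mul_eq_mul_div, div_lt_iff₀ (by positivity)]
    nlinarith
  refine ⟨perturbedNN ε α, nnCoupling_le_perturbedNN hε0.le α, fun x y => ?_, ?_, ?_, ?_, h ε α hε0 hα0 hα2⟩
  · exact (abs_perturbedNN_sub_nnCoupling_le (by linarith) ε x y).trans_lt (by rwa [abs_of_pos hε0])
  · have hsum := summable_rpow_norm_mul_algebraicCoupling hα0 hαs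
    refine (hsum.mul_left ε).congr fun y => ?_
    rw [perturbedNN_sub_nnCoupling, abs_mul, abs_of_pos hε0,
      abs_of_nonneg (algebraicCoupling_nonneg zero_le_one α 0 y)]
    ring
  · rw [tsum_rpow_norm_mul_abs_perturbedNN_sub, abs_of_pos hε0]
    exact hεK
  · exact not_summable_rpow_norm_mul_perturbedNN hε0 hα0.le hα2.le

/-- **No open (perturbation-stable) route.** Granted the barrier: if a property `Φ` of couplings holds
for every member `J^{(ε,α)}` (`0 < α`, `s < α < 3/2`, where the weighted sums converge) that is `δ`-close to
`J_nn` in `ℓ¹_s` (some `s < 3/2`, `δ > 0`) — e.g. any `Φ` that is an `ℓ¹_s`-open condition at `J_nn` within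
reflection-positive ferromagnets —
then `Φ` does not imply a non-Gaussian critical smearing. Any proof of clause (iii) for the nearest-neighbour
model must use an input that is destroyed by arbitrarily small heavy-tailed perturbations.
[cite: Panis2023Triviality, Theorem 5.5 and Remark 5.4, p. 21] -/
theorem PerturbativeTrivialityOnZ3.no_open_route (h : PerturbativeTrivialityOnZ3)
    (Φ : (Site 3 → Site 3 → ℝ) → Prop) {s δ : ℝ} (hs : s < 3 / 2) (hδ : 0 < δ)
    (hopen : ∀ ε α : ℝ, 0 < ε → 0 < α → s < α → α < 3 / 2 →
      (∑' y : Site 3, ‖y‖ ^ s * |perturbedNN ε α 0 y - nnCoupling 3 0 y|) < δ → Φ (perturbedNN ε α))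
    (hΦ : ∀ J, Φ J → HasNonGaussianSmearingZ3 J) : False := by
  set α : ℝ := (max s 1 + 3 / 2) / 2 with hα
  have hmax : max s 1 < 3 / 2 := max_lt hs (by norm_num)
  have hα1 : max s 1 < α := by rw [hα]; linarith
  have hα2 : α < 3 / 2 := by rw [hα]; linarith
  have hαs : s < α := lt_of_le_of_lt (le_max_left _ _) hα1
  have hα0 : 0 < α := lt_of_le_of_lt (by positivity) hα1
  obtain ⟨-, hlim⟩ := tendsto_weightedDist_perturbedNN_nnCoupling hα0 hαs
  have hev : ∀ᶠ ε : ℝ in 𝓝[>] 0,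
      (∑' y : Site 3, ‖y‖ ^ s * |perturbedNN ε α 0 y - nnCoupling 3 0 y|) < δ ∧ 0 < ε := by
    refine Filter.Eventually.and ?_ self_mem_nhdsWithin
    exact tendsto_nhdsWithin_of_tendsto_nhds hlim (Iio_mem_nhds hδ)
  obtain ⟨ε, hεd, hε0⟩ := hev.exists
  exact h ε α hε0 hα0 hα2 (hΦ _ (hopen ε α hε0 hα0 hαs hα2 hεd))

/-- **The Hamiltonian-level dividing quantity is the `3/2`-moment of the coupling** (unconditional): every
contrary model of this barrier — `J^{(ε,α)}`, `ε > 0`, `0 ≤ α < 3/2`, and likewise Panis's `C₀|x-y|₁^{-3-α}` —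
has `𝔪_{3/2}(J) = ∑_y ‖y‖^{3/2} J_{0,y} = ∞`, whereas `𝔪_s(J_nn) < ∞` for every `s`. So the light-tail input
"`𝔪_{3/2}(J) < ∞`" separates the nearest-neighbour model from all of them (compare the role of `𝔪₂(J)` at
`d = 4`: "When `𝔪₂(J) = ∞`, the decay of the interaction is slow enough to conclude using [the tree diagram
bound]"). [cite: Panis2023Triviality, §1.2.1, Theorem 1.3 and the definition of 𝔪₂(J), p. 7] -/
theorem moment_threeHalves_dichotomy :
    (∀ s : ℝ, Summable fun y : Site 3 => ‖y‖ ^ s * nnCoupling 3 0 y) ∧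
    (∀ ε α : ℝ, 0 < ε → 0 ≤ α → α < 3 / 2 → ¬ Summable fun y : Site 3 => ‖y‖ ^ ((3 : ℝ) / 2) * perturbedNN ε α 0 y) ∧
    (∀ C₀ α : ℝ, 0 < C₀ → 0 ≤ α → α < 3 / 2 →
      ¬ Summable fun y : Site 3 => ‖y‖ ^ ((3 : ℝ) / 2) * algebraicCoupling 3 C₀ α 0 y) :=
  ⟨summable_rpow_norm_mul_nnCoupling,
    fun _ _ hε hα hα' => not_summable_rpow_norm_mul_perturbedNN hε hα hα'.le,
    fun _ _ hC₀ hα hα' => not_summable_rpow_norm_mul_algebraicCoupling hC₀ hα hα'.le⟩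

/-- **Relation to the catalogued classes.** Granted its infrared bound, each contrary model `J^{(ε,α)}` lies
in the bubble-blind class of `BubbleTrivialityOnZ3` (finite critical bubble, MMS2) — so at the level of
TWO-POINT hypotheses this audit adds no model; what it adds is at the level of the INTERACTION: the contrary
models accumulate at `J_nn` itself. [cite: Panis2023Triviality, Theorem 5.5 and Theorem 12.2] -/
theorem perturbedNN_mem_bubbleBlind {ε α : ℝ} (hε : 0 ≤ ε) (hα : 0 < α) (hα' : α < 3 / 2)
    (hirb : HasCriticalDecay (perturbedNN ε α) (3 - α)) :
    (∀ x y, 0 ≤ perturbedNN ε α x y) ∧ (∀ a x y, perturbedNN ε α (x + a) (y + a) = perturbedNN ε α x y) ∧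
    (0 < LongRangeIsing.criticalBeta (perturbedNN ε α) → ∀ x y : Site 3, (3 : ℝ) * ‖x‖ ≤ ‖y‖ →
      pairCorrelation (perturbedNN ε α) (LongRangeIsing.criticalBeta (perturbedNN ε α)) 0 y ≤
        pairCorrelation (perturbedNN ε α) (LongRangeIsing.criticalBeta (perturbedNN ε α)) 0 x) ∧
    (Summable fun x : Site 3 =>
      pairCorrelation (perturbedNN ε α) (LongRangeIsing.criticalBeta (perturbedNN ε α)) 0 x ^ 2) :=
  ⟨perturbedNN_nonneg hε α, perturbedNN_add ε α,
    fun _ _ _ hxy => perturbedNN_mms2 hε hα.le (criticalBeta_nonneg _) hxy,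
    summable_sq_pairCorrelation_of_decay _ (perturbedNN_nonneg hε α) (by linarith) hirb⟩

end Literature.Barriers.CriticalPhenomena

end
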